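import Mathlib
import Literature.Barriers.NavierStokesRegularity.DyadicInvariantRegion
import Literature.Analysis.ODE.MaximalTime
import Summits.NavierStokesRegularity.NavierStokesRegularity.Theorems.SubOnsagerCeilingDyadicTwoCutExit
import HarnessLib

/-!
# Window region with TWO linear cuts for the rescaled Katz–Pavlović chain — abstract first-exit lemma
(helper file for crux stmt-NavierStokesRegularity-27057 `SubOnsagerCeiling.ForwardTailCeilingKP`, `--supports`)
`DyadicTwoCut.invariantRegionTwoCut_le_one_of_tail` = `DyadicMidRange.invariantRegionCut_le_one_of_tail` (sibling file
`SubOnsagerCeilingDyadicMidRangeRegion`) plus a SECOND linear three-window cut `e₂Yₙ + f₂Y_{n+1} + g₂Y_{n+2} ≤ d₂` (any signs);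
all inward-pointing inequalities are hypotheses (`hT`, `hB`, `hC`, `hC2`), each receiving both cuts on the neighbouring
windows; `hsmall2`/`hC20` = admissibility of the small box / of the window below the datum shell. Purpose: one-cut templates
certify the chain ceiling only down to `b ≈ 1.56` (LEAD census, crux 27057); the second cut is the next rung's freedom.
HONEST FRAMING: abstract ODE lemma towards a MODEL-lattice statement (rung under crux `ForwardTailCeilingKP`, route
SubOnsagerCeiling, TL-M2Break); nothing here bears on Navier–Stokes regularity. [cite: BarbatoMorandinRomito2011, §2 Lemma 2.1]
-/

noncomputable section

-- the sub-problem namespace `NavierStokesRegularity.NavierStokesRegularity` is the tree's layout (D-0017)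
set_option linter.dupNamespace false

namespace Summit.NavierStokesRegularity.NavierStokesRegularity.Theorems.DyadicTwoCut

open Set Filter Topology
open Literature.Barriers.NavierStokesRegularity.Dyadic
open Summit.NavierStokesRegularity.NavierStokesRegularity.Theorems.DyadicMidRange

/-- **Window region with two linear cuts on an infinite chain with a quiescent tail** (see the module
docstring). Inward-pointing facts are hypotheses: `hpc` (right piece), `hT`, `hB`, `hC` (first cut),
`hC2` (second cut); `hC0`/`hC20` give the cuts one window below the datum shell (`Y₀ = 0`).
[cite: BarbatoMorandinRomito2011, §2 Lemma 2.1] -/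
theorem invariantRegionTwoCut_le_one_of_tail {Y : ℕ → ℝ → ℝ} {κ F : ℕ → ℝ}
    {L p c s θ₀ m₁ m₂ a b₁ d e₂ f₂ g₂ d₂ : ℝ} {K : ℕ}
    (hs : 0 < s)
    (hκ : ∀ n, 0 < κ n) (hκmono : ∀ n, κ n ≤ κ (n + 1)) (hκ4 : ∀ n, κ (n + 1) ≤ 4 * κ n)
    (hF : ∀ n, 0 < F n) (hFL : ∀ n, F (n + 1) = L * F n)
    (_hc : 0 ≤ c) (hpc : 1 ≤ p * c) (hp : 0 ≤ p)
    (hθ₀ : 1 / 10 ≤ θ₀) (hm : ∀ x, 0 ≤ x → x ≤ 1 → 0 ≤ m₁ + m₂ * x) (ha : 0 ≤ a) (hb₁ : 0 ≤ b₁)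
    (hd : a / 10 + 1 / 10 ≤ d)
    (hC0 : ∀ x y : ℝ, 0 ≤ x → x ≤ 1 → 0 ≤ y → y ≤ θ₀ + m₁ * x + m₂ * x ^ 2 → -b₁ * x + y ≤ d)
    (hsmall2 : ∀ x y z : ℝ, 0 ≤ x → x ≤ 1 / 10 → 0 ≤ y → y ≤ 1 / 10 → 0 ≤ z → z ≤ 1 / 10 →
      e₂ * x + f₂ * y + g₂ * z ≤ d₂)
    (hC20 : ∀ x y : ℝ, 0 ≤ x → x ≤ 1 → 0 ≤ y → y ≤ 1 → y ≤ θ₀ + m₁ * x + m₂ * x ^ 2 →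
      (x ≤ 1 / 10 ∨ c * ((x - 1 / 10) / (9 / 10)) ^ 4 ≤ y) → f₂ * x + g₂ * y ≤ d₂)
    (hT : ∀ κ0 κ1 Fn x w z : ℝ, 0 < κ0 → κ0 ≤ κ1 → 0 < Fn → 0 ≤ x → x ≤ 1 →
      (θ₀ + m₁ * x + m₂ * x ^ 2) ≤ 1 → 0 ≤ w → w ≤ 1 → 0 ≤ z → z ≤ 1 →
      c * (((θ₀ + m₁ * x + m₂ * x ^ 2) - 1 / 10) / (9 / 10)) ^ 4 ≤ z →
      a * w - b₁ * x + (θ₀ + m₁ * x + m₂ * x ^ 2) ≤ d → a * x - b₁ * (θ₀ + m₁ * x + m₂ * x ^ 2) + z ≤ d →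
      e₂ * w + f₂ * x + g₂ * (θ₀ + m₁ * x + m₂ * x ^ 2) ≤ d₂ → e₂ * x + f₂ * (θ₀ + m₁ * x + m₂ * x ^ 2) + g₂ * z ≤ d₂ →
      (-κ1 * (θ₀ + m₁ * x + m₂ * x ^ 2) + L * Fn * (x ^ 2 - p * (θ₀ + m₁ * x + m₂ * x ^ 2) * z)) -
        (m₁ + 2 * m₂ * x) * (-κ0 * x + Fn * (w ^ 2 - p * x * (θ₀ + m₁ * x + m₂ * x ^ 2))) < 0)
    (hB : ∀ κ0 κ1 Fn x y z w : ℝ, 0 < κ0 → κ1 ≤ 4 * κ0 → 0 < Fn → 1 / 10 < x → x ≤ 1 →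
      y = c * ((x - 1 / 10) / (9 / 10)) ^ 4 → 0 ≤ z → z ≤ 1 → z ≤ θ₀ + m₁ * y + m₂ * y ^ 2 →
      a * x - b₁ * y + z ≤ d → 0 ≤ w → w ≤ 1 →
      a * w - b₁ * x + y ≤ d → e₂ * w + f₂ * x + g₂ * y ≤ d₂ → e₂ * x + f₂ * y + g₂ * z ≤ d₂ →
      4 * c * ((x - 1 / 10) / (9 / 10)) ^ 3 / (9 / 10) * (-κ0 * x + Fn * (w ^ 2 - p * x * y)) -
        (-κ1 * y + L * Fn * (x ^ 2 - p * y * z)) < 0)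
    (hC : ∀ κ0 κ1 κ2 Fn w x y z v : ℝ, 0 < κ0 → κ0 ≤ κ1 → κ1 ≤ κ2 → κ1 ≤ 4 * κ0 →
      κ2 ≤ 4 * κ1 → 0 < Fn → 0 ≤ w → w ≤ 1 → 0 ≤ x → x ≤ 1 → 0 ≤ y → y ≤ 1 → 0 ≤ z → z ≤ 1 →
      0 ≤ v → v ≤ 1 → a * x - b₁ * y + z = d →
      (w ≤ 1 / 10 ∨ c * ((w - 1 / 10) / (9 / 10)) ^ 4 ≤ x) → a * w - b₁ * x + y ≤ d →
      (x ≤ 1 / 10 ∨ c * ((x - 1 / 10) / (9 / 10)) ^ 4 ≤ y) → y ≤ θ₀ + m₁ * x + m₂ * x ^ 2 →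
      (y ≤ 1 / 10 ∨ c * ((y - 1 / 10) / (9 / 10)) ^ 4 ≤ z) → z ≤ θ₀ + m₁ * y + m₂ * y ^ 2 →
      (z ≤ 1 / 10 ∨ c * ((z - 1 / 10) / (9 / 10)) ^ 4 ≤ v) → v ≤ θ₀ + m₁ * z + m₂ * z ^ 2 →
      a * y - b₁ * z + v ≤ d →
      e₂ * w + f₂ * x + g₂ * y ≤ d₂ → e₂ * x + f₂ * y + g₂ * z ≤ d₂ → e₂ * y + f₂ * z + g₂ * v ≤ d₂ →
      a * (-κ0 * x + Fn * (w ^ 2 - p * x * y)) - b₁ * (-κ1 * y + L * Fn * (x ^ 2 - p * y * z)) +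
        (-κ2 * z + L * L * Fn * (y ^ 2 - p * z * v)) < 0)
    (hC2 : ∀ κ0 κ1 κ2 Fn w x y z v : ℝ, 0 < κ0 → κ0 ≤ κ1 → κ1 ≤ κ2 → κ1 ≤ 4 * κ0 →
      κ2 ≤ 4 * κ1 → 0 < Fn → 0 ≤ w → w ≤ 1 → 0 ≤ x → x ≤ 1 → 0 ≤ y → y ≤ 1 → 0 ≤ z → z ≤ 1 →
      0 ≤ v → v ≤ 1 → e₂ * x + f₂ * y + g₂ * z = d₂ →
      (w ≤ 1 / 10 ∨ c * ((w - 1 / 10) / (9 / 10)) ^ 4 ≤ x) →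
      a * w - b₁ * x + y ≤ d → e₂ * w + f₂ * x + g₂ * y ≤ d₂ →
      (x ≤ 1 / 10 ∨ c * ((x - 1 / 10) / (9 / 10)) ^ 4 ≤ y) → y ≤ θ₀ + m₁ * x + m₂ * x ^ 2 →
      a * x - b₁ * y + z ≤ d →
      (y ≤ 1 / 10 ∨ c * ((y - 1 / 10) / (9 / 10)) ^ 4 ≤ z) → z ≤ θ₀ + m₁ * y + m₂ * y ^ 2 →
      a * y - b₁ * z + v ≤ d → e₂ * y + f₂ * z + g₂ * v ≤ d₂ →
      (z ≤ 1 / 10 ∨ c * ((z - 1 / 10) / (9 / 10)) ^ 4 ≤ v) → v ≤ θ₀ + m₁ * z + m₂ * z ^ 2 →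
      e₂ * (-κ0 * x + Fn * (w ^ 2 - p * x * y)) + f₂ * (-κ1 * y + L * Fn * (x ^ 2 - p * y * z)) +
        g₂ * (-κ2 * z + L * L * Fn * (y ^ 2 - p * z * v)) < 0)
    (hY0 : ∀ t, Y 0 t = 0)
    (hcont : ∀ n, ContinuousOn (Y n) (Icc 0 s))
    (hderiv : ∀ n, 1 ≤ n → ∀ t ∈ Ico 0 s,
      HasDerivWithinAt (Y n) (-κ n * Y n t + F n * (Y (n - 1) t ^ 2 - p * Y n t * Y (n + 1) t))
        (Ici t) t)
    (hpos : ∀ n, ∀ t ∈ Icc 0 s, 0 ≤ Y n t)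
    (hinit : ∀ n, Y n 0 ≤ 1 / 10)
    (htail : ∀ n, K ≤ n → ∀ t ∈ Icc 0 s, Y n t ≤ 1 / 10) :
    ∀ n, ∀ t ∈ Icc 0 s, Y n t ≤ 1 := by
  set h : ℝ → ℝ := fun x => if x ≤ 1 / 10 then (0 : ℝ) else c * ((x - 1 / 10) / (9 / 10)) ^ 4 with hh
  set g : ℝ → ℝ := fun x => θ₀ + m₁ * x + m₂ * x ^ 2 with hg
  have hg_ge : ∀ x, 0 ≤ x → x ≤ 1 → 1 / 10 ≤ g x := by
    intro x hx0 hx1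
    have := hm x hx0 hx1
    have e : g x = θ₀ + x * (m₁ + m₂ * x) := by simp only [hg]; ring
    rw [e]; nlinarith
  have hg_cont : Continuous g := by
    have : g = fun x => θ₀ + m₁ * x + m₂ * x ^ 2 := rfl
    rw [this]; fun_prop
  have hg_deriv : ∀ x, HasDerivAt g (m₁ + 2 * m₂ * x) x := by
    intro x
    have h1 : HasDerivAt (fun x : ℝ => m₁ * x + m₂ * x ^ 2) (m₁ * 1 + m₂ * (↑2 * x ^ (2 - 1) * 1)) x :=
      ((hasDerivAt_id' x).const_mul m₁).add (((hasDerivAt_id' x).pow 2).const_mul m₂)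
    have h2 := h1.const_add θ₀
    have e : (fun x : ℝ => θ₀ + (m₁ * x + m₂ * x ^ 2)) = g := by
      funext y; simp only [hg]; ring
    rw [e] at h2
    refine h2.congr_deriv ?_
    push_cast; ring
  set P : ℝ → Prop := fun t =>
    (∀ n ∈ Finset.Icc 1 K, Y n t ≤ 1) ∧
      (∀ n ∈ Finset.Icc 1 K, Y (n + 1) t ≤ g (Y n t)) ∧
      (∀ n ∈ Finset.Icc 1 K, h (Y n t) ≤ Y (n + 1) t) ∧
      (∀ n ∈ Finset.Icc 1 K, a * Y n t - b₁ * Y (n + 1) t + Y (n + 2) t ≤ d) ∧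
      (∀ n ∈ Finset.Icc 1 K, e₂ * Y n t + f₂ * Y (n + 1) t + g₂ * Y (n + 2) t ≤ d₂) with hP
  have hsmall : ∀ t ∈ Icc (0 : ℝ) s, P t →
      (∀ n, Y n t ≤ 1) ∧ (∀ n, 1 ≤ n → Y (n + 1) t ≤ g (Y n t)) ∧
        (∀ n, 1 ≤ n → h (Y n t) ≤ Y (n + 1) t) ∧
        (∀ n, 1 ≤ n → a * Y n t - b₁ * Y (n + 1) t + Y (n + 2) t ≤ d) ∧
        (∀ n, 1 ≤ n → e₂ * Y n t + f₂ * Y (n + 1) t + g₂ * Y (n + 2) t ≤ d₂) := by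
    intro t ht hPt
    simp only [hP] at hPt
    obtain ⟨hR, hTt, hBt, hCt, hC2t⟩ := hPt
    have hle1 : ∀ n, Y n t ≤ 1 := by
      intro n
      rcases Nat.eq_zero_or_pos n with rfl | hn1
      · rw [hY0]; norm_num
      rcases le_or_gt K n with hKn | hnK
      · linarith [htail n hKn t ht]
      · exact hR n (Finset.mem_Icc.2 ⟨hn1, hnK.le⟩)
    refine ⟨hle1, fun n hn1 => ?_, fun n hn1 => ?_, fun n hn1 => ?_, fun n hn1 => ?_⟩
    · rcases le_or_gt n K with hnK | hKn
      · exact hTt n (Finset.mem_Icc.2 ⟨hn1, hnK⟩)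
      · have h1 := htail (n + 1) (by omega) t ht
        exact h1.trans (hg_ge _ (hpos n t ht) (hle1 n))
    · rcases le_or_gt n K with hnK | hKn
      · exact hBt n (Finset.mem_Icc.2 ⟨hn1, hnK⟩)
      · have h1 := htail n hKn.le t ht
        simp only [hh]; rw [lowerCurve_of_le h1]; exact hpos (n + 1) t ht
    · rcases le_or_gt n K with hnK | hKn
      · exact hCt n (Finset.mem_Icc.2 ⟨hn1, hnK⟩)
      · have h1 := htail n hKn.le t ht
        have h2 := htail (n + 2) (by omega) t ht
        have h3 := hpos (n + 1) t ht
        have h4 := hpos n t ht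
        nlinarith
    · rcases le_or_gt n K with hnK | hKn
      · exact hC2t n (Finset.mem_Icc.2 ⟨hn1, hnK⟩)
      · exact hsmall2 _ _ _ (hpos n t ht) (htail n hKn.le t ht) (hpos (n + 1) t ht)
          (htail (n + 1) (by omega) t ht) (hpos (n + 2) t ht) (htail (n + 2) (by omega) t ht)
  suffices key : ∀ t ∈ Icc 0 s, P t by
    intro n t ht
    exact (hsmall t ht (key t ht)).1 n
  have hP0 : P 0 := by
    have h0s : (0 : ℝ) ∈ Icc 0 s := ⟨le_rfl, hs.le⟩
    simp only [hP]
    refine ⟨fun n _ => ?_, fun n _ => ?_, fun n _ => ?_, fun n _ => ?_, fun n _ => ?_⟩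
    · linarith [hinit n]
    · have h1 := hinit (n + 1)
      have := hg_ge (Y n 0) (hpos n 0 h0s) (by linarith [hinit n])
      linarith
    · simp only [hh]; rw [lowerCurve_of_le (hinit n)]; exact hpos (n + 1) 0 h0s
    · have h1 := hinit n
      have h2 := hinit (n + 2)
      have h3 := hpos (n + 1) 0 h0s
      have h4 := hpos n 0 h0s
      nlinarith
    · exact hsmall2 _ _ _ (hpos n 0 h0s) (hinit n) (hpos (n + 1) 0 h0s) (hinit (n + 1))
        (hpos (n + 2) 0 h0s) (hinit (n + 2))
  have hclosed : ∀ t ∈ Ioc 0 s, (∀ r ∈ Ico 0 t, P r) → P t := by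
    intro t ht hPs
    simp only [hP] at hPs ⊢
    refine ⟨fun n hn => ?_, fun n hn => ?_, fun n hn => ?_, fun n hn => ?_, fun n hn => ?_⟩
    · exact le_of_forall_Ico_le (hcont n) continuousOn_const ht fun r hr => (hPs r hr).1 n hn
    · exact le_of_forall_Ico_le (hcont (n + 1)) (hg_cont.comp_continuousOn (hcont n)) ht
        fun r hr => (hPs r hr).2.1 n hn
    · exact le_of_forall_Ico_le ((continuous_lowerCurve c).comp_continuousOn (hcont n))
        (hcont (n + 1)) ht fun r hr => (hPs r hr).2.2.1 n hn
    · exact le_of_forall_Ico_le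
        ((((continuousOn_const.mul (hcont n)).sub (continuousOn_const.mul (hcont (n + 1)))).add
          (hcont (n + 2))))
        continuousOn_const ht fun r hr => (hPs r hr).2.2.2.1 n hn
    · exact le_of_forall_Ico_le
        ((((continuousOn_const.mul (hcont n)).add (continuousOn_const.mul (hcont (n + 1)))).add
          (continuousOn_const.mul (hcont (n + 2)))))
        continuousOn_const ht fun r hr => (hPs r hr).2.2.2.2 n hn
  set T := Literature.Analysis.ODE.maximalTimeP P 0 s with hTdef
  have hTmem : T ∈ Icc 0 s := Literature.Analysis.ODE.maximalTimeP_mem hs.le hP0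
  have hPT : ∀ t ∈ Icc 0 T, P t := fun t ht =>
    Literature.Analysis.ODE.maximalTimeP_spec hs.le hP0 hclosed ht
  by_contra hall
  have hTb : T < s := by
    rcases lt_or_eq_of_le hTmem.2 with hlt | heq
    · exact hlt
    · exact absurd (fun t ht => hPT t (heq ▸ ht)) hall
  have hT0 : 0 ≤ T := hTmem.1
  have hTs : T ∈ Icc 0 s := ⟨hT0, hTb.le⟩
  obtain ⟨hle1, hupp, hlow, hcut, hcut2⟩ := hsmall T hTs (hPT T ⟨hT0, le_rfl⟩)
  have hposT : ∀ k, 0 ≤ Y k T := fun k => hpos k T hTs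
  have hlow' : ∀ k, 1 ≤ k → (Y k T ≤ 1 / 10 ∨ c * ((Y k T - 1 / 10) / (9 / 10)) ^ 4 ≤ Y (k + 1) T) :=
    fun k hk => (lowerCurve_le_iff_or (hposT (k + 1))).1 (hlow k hk)
  have hcut' : ∀ k, a * Y k T - b₁ * Y (k + 1) T + Y (k + 2) T ≤ d := by
    intro k
    rcases Nat.eq_zero_or_pos k with rfl | hk
    · rw [hY0, mul_zero, zero_sub]
      have := hC0 (Y 1 T) (Y 2 T) (hposT 1) (hle1 1) (hposT 2) (hupp 1 le_rfl)
      linarith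
    · exact hcut k hk
  have hlow0 : ∀ k, (Y k T ≤ 1 / 10 ∨ c * ((Y k T - 1 / 10) / (9 / 10)) ^ 4 ≤ Y (k + 1) T) := by
    intro k
    rcases Nat.eq_zero_or_pos k with rfl | hk
    · left; rw [hY0]; norm_num
    · exact hlow' k hk
  have hcut2' : ∀ k, e₂ * Y k T + f₂ * Y (k + 1) T + g₂ * Y (k + 2) T ≤ d₂ := by
    intro k
    rcases Nat.eq_zero_or_pos k with rfl | hk
    · rw [hY0, mul_zero, zero_add]
      exact hC20 (Y 1 T) (Y 2 T) (hposT 1) (hle1 1) (hposT 2) (hle1 2) (hupp 1 le_rfl) (hlow' 1 le_rfl)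
    · exact hcut2 k hk
  have hnhds : Icc 0 s ∈ 𝓝[Ici T] T := Icc_mem_nhdsGE_of_mem ⟨hT0, hTb⟩
  have hcw : ∀ k, ContinuousWithinAt (Y k) (Ici T) T := fun k =>
    ((hcont k) T hTs).mono_of_mem_nhdsWithin hnhds
  have hd : ∀ k, 1 ≤ k → HasDerivWithinAt (Y k)
      (-κ k * Y k T + F k * (Y (k - 1) T ^ 2 - p * Y k T * Y (k + 1) T)) (Ici T) T :=
    fun k hk1 => hderiv k hk1 T ⟨hT0, hTb⟩
  have hright := twoCut_exit_step (K := K) hκ hκmono hκ4 hF hFL _hc hpc hp hθ₀ hm hT hB hC hC2 hpos hT0 hTb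
    hcw hd hle1 hupp hlow hlow0 hcut' hcut2'
  exact Literature.Analysis.ODE.not_eventually_of_maximalTimeP_lt hs.le hP0 hTb
    (eventually_nhdsWithin_Icc_of_left_of_right hPT (hright.mono fun t ht => by simp only [hP]; exact ht))

end Summit.NavierStokesRegularity.NavierStokesRegularity.Theorems.DyadicTwoCut

end
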